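import Summits.NavierStokesRegularity.NavierStokesRegularity.Theses.HardyPointSink
import Summits.NavierStokesRegularity.NavierStokesRegularity.Theorems.HardyPointSinkHardyEnergyBoundRegularTopBounds
import Summits.NavierStokesRegularity.NavierStokesRegularity.Theorems.HardyPointSinkHardyEnergyBoundConverse
import HarnessLib

/-!
# Route HardyPointSink — crux `HardyEnergyBound` (item stmt-NavierStokesRegularity-7979):
# the backward singular points are EXACTLY the points that drink divergent head

Support file (theorems only, `--supports stmt-NavierStokesRegularity-7979`; lead c7 of the crux
line, 2026-08-17).  Lead c6 proved (`…DivergentInflux`) that at every backward singular point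
`(T, x_*)` of a Kato solution from Clay data the cumulative head influx toward `x_*` DIVERGES as
`t ↑ T` (through the landed point-sink ledger, from the divergence of the Hardy dissipation).
This file proves the converse half at the REGULAR points of the final time, so that the source
currency of the ledger characterises the backward singular set exactly:

* `headInflux_le_of_not_isBackwardSingularPoint` — Kato solution `u` on `[0, T)`, classical
  representative `(v, p)` on `(0, T)`, `(T, x_*)` NOT a backward singular point of `u`: at some
  scale `0 < R`, `R² < T` the cumulative head influx toward every sink `x₀ ∈ B(x_*, R/4)` is
  BOUNDED ABOVE up to the final time (the frame of the converse
  `hardyEnergyBound_influxAbsorption_of_crux`: `−2I ≤ H_φ(t) + D_φ(t) + |∫Φ|`, with `H_φ`, `D_φ`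
  bounded at a regular point by the pointwise bounds on `v`, `∇v` of `…RegularTopBounds`).
* `isBackwardSingularPoint_iff_headInflux_unbounded` — with c6's theorem: **for Clay data,
  `(T, x_*)` is a backward singular point iff at every scale the head influx toward `x_*` tends to
  `+∞`**.  Together with `isBackwardSingularPoint_iff_hardyDissipation_eq_top`: the heart of the
  line `birth` (≡ the crux, `hardyEnergyBound_iff_influxAbsorption`, p153587) is precisely the
  statement that at the singular points the two divergent currencies differ by `O(1)`.

References: L. Caffarelli, R. Kohn, L. Nirenberg, Comm. Pure Appl. Math. 35 (1982), §2, §8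
[CKN1982]; G. Seregin, *Lecture Notes on Regularity Theory for the Navier–Stokes Equations*
(2014), Ch. 6, Thm. 1.4 [Seregin2014].
-/

-- the problem directory repeats the summit name (D-0017); core's `dupNamespace` linter fires
set_option linter.dupNamespace false

noncomputable section

open Set MeasureTheory Filter Topology TopologicalSpace Function Metric Module
open scoped ENNReal NNReal InnerProductSpace Laplacian
open Literature.Analysis.FluidPDE Literature.Analysis.FunctionSpaces Literature.Analysis.PDE

namespace Summit.NavierStokesRegularity.NavierStokesRegularity.Theorems

/-! ### At a regular point the cumulative head influx is bounded above -/

/-- **At a regular point of the final time the head influx toward every nearby sink is bounded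
above up to the final time.**  For `ν > 0`, `T > 0`, a Kato solution `u` on `[0, T)`, a classical
representative `(v, p)` on `(0, T)` and a point `x_*` with `(T, x_*)` NOT a backward singular point
of `u`, there are a scale `0 < R`, `R² < T` and `M` with
`−2 I(x₀; T−R², t) = −2∫_{T−R²}^{t}∫_{B(x_*,R)} (|v|²/2 + Π_Riesz[v(s)])⟨v, x − x₀⟩/|x − x₀|³ ≤ M`
for all sinks `x₀ ∈ B(x_*, R/4)` and all `t ∈ [T−R², T)`.  Proof: the frame of the converse
`hardyEnergyBound_influxAbsorption_of_crux` (plateau cut-off centred at the sink, scale `R/4`;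
localised identity `stub_localHardyIdentity`, pressure swap, space–time `L³` bound) gives
`−2I ≤ H_φ(t) + D_φ(t) + |∫Φ|` with `|∫Φ| ≤ αR² + β∫∫|v|³`; at a regular point `|v| ≤ A` and
`‖∇v‖ ≤ G` on `(T − r², T) × B(x_*, r)` (`bounds_near_top_of_not_isBackwardSingularPoint`), so for
`R < r` the terms `H_φ(t)` (`hardyEnergyBound_regular_ofReal_hardy_le`) and `D_φ(t)`
(`hardyEnergyBound_regular_ofReal_dissipation_le`) are bounded uniformly in the sink and `t < T`.
Converse of lead c6's `headInflux_unbounded_of_isBackwardSingularPoint`.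
[cite: CaffarelliKohnNirenberg1982, §2 and §8] -/
theorem headInflux_le_of_not_isBackwardSingularPoint {ν : ℝ} (hν : 0 < ν)
    {u₀ : EuclideanSpace ℝ (Fin 3) → EuclideanSpace ℝ (Fin 3)} {T : ℝ} (hT : 0 < T)
    {u : ℝ → EuclideanSpace ℝ (Fin 3) → EuclideanSpace ℝ (Fin 3)} (hu : IsKatoSolutionOn T ν u₀ u)
    {v : ℝ → EuclideanSpace ℝ (Fin 3) → EuclideanSpace ℝ (Fin 3)}
    {p : ℝ → EuclideanSpace ℝ (Fin 3) → ℝ} (hcl : IsClassicalNSSolutionOn (Ioo 0 T) ν 0 v p)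
    (hae : ∀ t ∈ Ioo 0 T, v t =ᵐ[volume] u t)
    {xs : EuclideanSpace ℝ (Fin 3)}
    (hreg : ¬ IsBackwardSingularPoint u ((T, xs) : ℝ × EuclideanSpace ℝ (Fin 3))) :
    ∃ R : ℝ, 0 < R ∧ R ^ 2 < T ∧ ∃ M : ℝ, ∀ x₀ ∈ ball xs (R / 4), ∀ t ∈ Ico (T - R ^ 2) T,
      -2 * ∫ s in (T - R ^ 2)..t, ∫ x in ball xs R,
        (‖v s x‖ ^ 2 / 2 + rieszPressure (v s) x) * inner ℝ (v s x) (x - x₀) / ‖x - x₀‖ ^ 3 ≤ M := by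
  obtain ⟨r, hr, A, G, hAG⟩ := bounds_near_top_of_not_isBackwardSingularPoint hν hT hu hcl hae hreg
  -- the scale `R < r`, `R² < T`
  set R : ℝ := min (r / 2) (Real.sqrt T / 2) with hRdef
  have hR : 0 < R := lt_min (by positivity) (by positivity)
  have hRr : R < r := (min_le_left _ _).trans_lt (by linarith)
  have hRT : R ^ 2 < T := by
    have h1 : R ≤ Real.sqrt T / 2 := min_le_right _ _
    have h2 : R ^ 2 ≤ (Real.sqrt T / 2) ^ 2 := pow_le_pow_left₀ hR.le h1 2
    have h3 : (Real.sqrt T / 2) ^ 2 = T / 4 := by rw [div_pow, Real.sq_sqrt hT.le]; norm_num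
    nlinarith
  have hR2 : R ^ 2 < r ^ 2 := pow_lt_pow_left₀ hRr hR.le two_ne_zero
  refine ⟨R, hR, hRT, ?_⟩
  -- basic facts on the strip
  have hIoo : IsOpen (Ioo (0 : ℝ) T) := isOpen_Ioo
  have ha0 : 0 < T - R ^ 2 := by linarith
  have hsm_v : IsSmoothSpaceTimeOn (Ioo 0 T) v := hcl.smooth_velocity
  have hsm_p : IsSmoothSpaceTimeOn (Ioo 0 T) p := hcl.smooth_pressure
  have hvc : ∀ s ∈ Ioo 0 T, Continuous (v s) := fun s hs => (hcl.contDiff_velocity hs).continuous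
  have hpc : ∀ s ∈ Ioo 0 T, Continuous (p s) := fun s hs => (hcl.contDiff_pressure hs).continuous
  have hv3 : ∀ s ∈ Ioo 0 T, MemLp (v s) 3 volume := fun s hs =>
    hardyEnergyBound_ledger_memLp_three hu hae hs
  -- the window `(T - R², T)` lies in the region of the pointwise bounds
  have hwin : ∀ s, T - R ^ 2 ≤ s → s < T → s ∈ Ioo (T - r ^ 2) T := fun s h1 h2 => ⟨by linarith, h2⟩
  -- the cut-off scale `R/4` and the centre-independent constants
  have hρ : 0 < R / 4 := by positivity
  obtain ⟨L₁, L₂, hL₁0, hL₂0, hL₁, hL₂⟩ := hardyEnergyBound_converse_exists_bounds hρ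
  set V : ℝ := (volume : Measure (EuclideanSpace ℝ (Fin 3))).real
    (closedBall (0 : EuclideanSpace ℝ (Fin 3)) (R / 4)) with hV
  set Cst : ℝ := (steinConstThreeHalves : ℝ) with hCst
  have hV0 : 0 ≤ V := measureReal_nonneg
  have hCst0 : 0 ≤ Cst := NNReal.coe_nonneg _
  set aA : ℝ := |ν| * (L₂ * (4 / (R / 4)) + 2 * L₁ * (16 / (R / 4) ^ 2)) with haA
  set aB : ℝ := 4 * L₁ / (R / 4) * (1 + 2 * Cst) with haB
  set aD : ℝ := 16 / (R / 4) ^ 2 * (1 / 2 + Cst) with haD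
  have haA0 : 0 ≤ aA := by positivity
  have haB0 : 0 ≤ aB := by positivity
  have haD0 : 0 ≤ aD := by positivity
  set α : ℝ := aA * V with hα
  set β : ℝ := aA + aB + 2 * aD with hβ
  have hα0 : 0 ≤ α := by positivity
  have hβ0 : 0 ≤ β := by positivity
  -- the space–time `L³` bound
  have hfin : ∫⁻ s in Ioo (T - R ^ 2) T, ∫⁻ x, ‖v s x‖ₑ ^ 3 < ⊤ :=
    hardyEnergyBound_ledger_lintegral_lintegral_lt_top
      (hsm_v.continuousOn.mono (prod_mono (Ioo_subset_Ioo_left ha0.le) Subset.rfl))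
      (stub_spaceTimeL3 ν hν T u₀ u hT hu v p hcl hae (T - R ^ 2) ha0 (by nlinarith))
  set N : ℝ≥0∞ := ∫⁻ s in Ioo (T - R ^ 2) T, ∫⁻ x, ‖v s x‖ₑ ^ 3 with hN
  set C₁ : ℝ≥0∞ := ENNReal.ofReal α * ENNReal.ofReal (R ^ 2) + ENNReal.ofReal β * N with hC₁
  have hC₁top : C₁ ≠ ⊤ := ENNReal.add_ne_top.2 ⟨ENNReal.mul_ne_top ENNReal.ofReal_ne_top
    ENNReal.ofReal_ne_top, ENNReal.mul_ne_top ENNReal.ofReal_ne_top hfin.ne⟩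
  -- the constants bounding the Hardy energy and the dissipation at a regular point
  set V₁ : ℝ := (volume : Measure (EuclideanSpace ℝ (Fin 3))).real (ball (0 : EuclideanSpace ℝ (Fin 3)) 1)
    with hV₁
  set KH : ℝ≥0∞ := ENNReal.ofReal (A ^ 2 * (5 / 2 * V₁ * (R / 4) ^ 2)) with hKH
  set KD : ℝ≥0∞ := (ENNReal.ofReal (2 * ν) * (ENNReal.ofReal (3 * G ^ 2) *
      ENNReal.ofReal (5 / 2 * V₁ * (R / 4) ^ 2)) +
    ENNReal.ofReal (4 * Real.pi * ν) * ENNReal.ofReal (A ^ 2)) * volume (Ioo (T - R ^ 2) T) with hKD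
  have hKDtop : KD ≠ ⊤ := by
    refine ENNReal.mul_ne_top (ENNReal.add_ne_top.2 ⟨ENNReal.mul_ne_top ENNReal.ofReal_ne_top
      (ENNReal.mul_ne_top ENNReal.ofReal_ne_top ENNReal.ofReal_ne_top),
      ENNReal.mul_ne_top ENNReal.ofReal_ne_top ENNReal.ofReal_ne_top⟩) ?_
    rw [Real.volume_Ioo]
    exact ENNReal.ofReal_ne_top
  set Mₑ : ℝ≥0∞ := KH + KD + C₁ with hMₑ
  have hMₑtop : Mₑ ≠ ⊤ :=
    ENNReal.add_ne_top.2 ⟨ENNReal.add_ne_top.2 ⟨ENNReal.ofReal_ne_top, hKDtop⟩, hC₁top⟩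
  refine ⟨Mₑ.toReal, ?_⟩
  intro x₀ hx₀ t ht
  obtain ⟨ht1, htT⟩ := ht
  have hx₀d : dist x₀ xs < R / 4 := mem_ball.1 hx₀
  have hx₀r : x₀ ∈ ball xs r := mem_ball.2 (by linarith)
  -- the plateau cut-off CENTRED AT THE SINK, scale `R/4`
  set φ := hardyEnergyBound_ledger_cutoff x₀ hρ with hφ
  have hx₀' : x₀ ∈ ball x₀ (R / 4 / 4) := mem_ball_self (by positivity)
  have hφs : ContDiff ℝ (⊤ : ℕ∞) φ := hardyEnergyBound_ledger_cutoff_contDiff x₀ hρ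
  have hφc : HasCompactSupport φ := hardyEnergyBound_ledger_cutoff_hasCompactSupport x₀ hρ
  have hL₁x : ∀ x, ‖fderiv ℝ φ x‖ ≤ L₁ := hL₁ x₀
  have hL₂x : ∀ x, |(Δ φ) x| ≤ L₂ := hL₂ x₀
  have hsub2 : ball x₀ (R / 4) ⊆ ball xs (R / 2) := fun x hx => by
    rw [mem_ball] at hx ⊢
    linarith [dist_triangle x x₀ xs]
  have hsubR : ball x₀ (R / 4) ⊆ ball xs R :=
    hsub2.trans (ball_subset_ball (by linarith))
  have hsubr : ball x₀ (R / 4) ⊆ ball xs r :=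
    hsub2.trans (ball_subset_ball (by linarith))
  have hVx : (volume : Measure (EuclideanSpace ℝ (Fin 3))).real (closedBall x₀ (R / 4)) = V := by
    rw [hV, measureReal_def, measureReal_def, Measure.addHaar_closedBall_center]
  -- the time window `K = [T - R², t]` inside `(0, S')`, `S' = (t + T)/2`
  set S' : ℝ := (t + T) / 2 with hS'
  have htS' : t < S' := by rw [hS']; linarith
  have hS'T : S' < T := by rw [hS']; linarith
  have hKT : Icc (T - R ^ 2) t ⊆ Ioo 0 T := fun s hs => ⟨ha0.trans_le hs.1, hs.2.trans_lt htT⟩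
  have hKS' : Icc (T - R ^ 2) t ⊆ Ioo 0 S' := fun s hs => ⟨ha0.trans_le hs.1, hs.2.trans_lt htS'⟩
  have hKc : IsCompact (Icc (T - R ^ 2) t) := isCompact_Icc
  have hUI : uIcc (T - R ^ 2) t = Icc (T - R ^ 2) t := uIcc_of_le ht1
  -- pressure normalisation on `(0, S')`
  have hcl' : IsClassicalNSSolutionOn (Ioo 0 S') ν 0 v p :=
    hcl.mono (Ioo_subset_Ioo_right hS'T.le) isOpen_Ioo.uniqueDiffOn
  obtain ⟨Mv, hMv⟩ := (hu.continuousInLpOn.mono (fun s hs => ⟨hs.1, hs.2.trans_lt hS'T⟩ :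
    Icc 0 S' ⊆ Ico 0 T)).exists_forall_eLpNorm_le_Icc
  have hMv' : ∀ s ∈ Ioo 0 S', eLpNorm (v s) 3 volume ≤ Mv := fun s hs => by
    rw [eLpNorm_congr_ae (hae s ⟨hs.1, hs.2.trans hS'T⟩)]
    exact hMv s ⟨hs.1.le, hs.2.le⟩
  have hex : ∀ s, ∃ c : ℝ, s ∈ Ioo 0 S' →
      ∀ᵐ x ∂(volume : Measure (EuclideanSpace ℝ (Fin 3))), p s x = rieszPressure (v s) x + c := by
    intro s
    by_cases hs : s ∈ Ioo 0 S'
    · obtain ⟨c, hc⟩ := PressureNormalisationL3.pressure_ae_eq_rieszPressure_add_const hν.le hcl'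
        (fun s hs => hv3 s ⟨hs.1, hs.2.trans hS'T⟩) hMv' hs
      exact ⟨c, fun _ => hc⟩
    · exact ⟨0, fun h => absurd h hs⟩
  choose c hc using hex
  have hcK : ∀ s ∈ Icc (T - R ^ 2) t, ∀ᵐ x ∂(volume : Measure (EuclideanSpace ℝ (Fin 3))),
      p s x = rieszPressure (v s) x + c s := fun s hs => hc s (hKS' hs)
  -- the solenoidal flux identity on each slice
  have hsol : ∀ s ∈ Ioo 0 T, ∫ x, fderiv ℝ φ x (v s x) / ‖x - x₀‖ =
      ∫ x, φ x * inner ℝ (v s x) (x - x₀) / ‖x - x₀‖ ^ 3 := fun s hs =>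
    stub_solenoidalHardyFlux (v s) (hcl.contDiff_velocity hs) (hcl.divFree s hs) φ hφs hφc x₀
  -- the time functions
  set Gf : ℝ → ℝ := fun s => ∫ x, (hardyEnergyBound_ledgerA ν φ (v s) x₀ x +
    hardyEnergyBound_ledgerB φ (v s) (p s) x₀ x - hardyEnergyBound_ledgerC φ (v s) (p s) x₀ x) with hGf
  set F : ℝ → ℝ := fun s => ∫ x in ball xs R,
    hardyEnergyBound_ledgerFlux (v s) (rieszPressure (v s)) x₀ x with hF
  set Φ : ℝ → ℝ := fun s => (∫ x, hardyEnergyBound_ledgerA ν φ (v s) x₀ x) +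
    (∫ x, hardyEnergyBound_ledgerB φ (v s) (rieszPressure (v s)) x₀ x) -
    2 * (∫ x in ball xs R, (φ x - 1) * hardyEnergyBound_ledgerFlux (v s) (rieszPressure (v s)) x₀ x)
    with hΦ
  set X : ℝ → ℝ := fun s => ∫ x, φ x * frobeniusNormSq (fderiv ℝ (v s) x) / ‖x - x₀‖ with hX
  set Y : ℝ → ℝ := fun s => ‖v s x₀‖ ^ 2 with hY
  -- (1) slice by slice: `Gf = Φ - 2F` and `|Φ| ≤ α + β ∫|v s|³`
  have hGΦ : ∀ s ∈ Icc (T - R ^ 2) t, Gf s = Φ s - 2 * F s := fun s hs => by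
    have hsI := hKT hs
    have e : Gf s = (∫ x, hardyEnergyBound_ledgerA ν φ (v s) x₀ x) +
        (∫ x, hardyEnergyBound_ledgerB φ (v s) (rieszPressure (v s)) x₀ x) -
        2 * (∫ x in ball x₀ (R / 4), (φ x - 1) *
          hardyEnergyBound_ledgerFlux (v s) (rieszPressure (v s)) x₀ x) -
        2 * (∫ x in ball x₀ (R / 4), hardyEnergyBound_ledgerFlux (v s) (rieszPressure (v s)) x₀ x) :=
      hardyEnergyBound_ledger_pressure_swap hρ hx₀' hL₁0 hL₂0 hL₁x hL₂x (hvc s hsI) (hv3 s hsI) ν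
        (hpc s hsI) (hcK s hs) (hsol s hsI)
    have h1 := hardyEnergyBound_converse_influx_collect (c := x₀) (x₀ := x₀) (xs := x₀)
      (R := R / 4) hρ Subset.rfl (hvc s hsI) (hpc s hsI) (hcK s hs)
    have h2 := hardyEnergyBound_converse_influx_collect (x₀ := x₀) hρ hsubR (hvc s hsI)
      (hpc s hsI) (hcK s hs)
    have eΦ : Φ s = (∫ x, hardyEnergyBound_ledgerA ν φ (v s) x₀ x) +
        (∫ x, hardyEnergyBound_ledgerB φ (v s) (rieszPressure (v s)) x₀ x) -
        2 * (∫ x in ball xs R, (φ x - 1) *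
          hardyEnergyBound_ledgerFlux (v s) (rieszPressure (v s)) x₀ x) := rfl
    have eF : F s = ∫ x in ball xs R, hardyEnergyBound_ledgerFlux (v s) (rieszPressure (v s)) x₀ x :=
      rfl
    rw [e, eΦ, eF]
    linarith
  have hΦb : ∀ s ∈ Icc (T - R ^ 2) t, |Φ s| ≤ α + β * ∫ x, ‖v s x‖ ^ 3 := fun s hs => by
    have hw := hvc s (hKT hs)
    have hw3 := hv3 s (hKT hs)
    have h1 := hardyEnergyBound_ledger_abs_integral_ledgerA_le hρ hx₀' hL₁0 hL₂0 hL₁x hL₂x hw hw3 ν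
    rw [hVx] at h1
    have h2 := hardyEnergyBound_ledger_abs_integral_ledgerB_le hρ hx₀' hL₁0 hL₁x hw hw3
    have h3 := hardyEnergyBound_converse_abs_integral_deficit_le hρ hx₀' hw3 (ball xs R)
    have hN0 : 0 ≤ ∫ x, ‖v s x‖ ^ 3 := integral_nonneg fun x => by positivity
    calc |Φ s| ≤ |∫ x, hardyEnergyBound_ledgerA ν φ (v s) x₀ x| +
          |∫ x, hardyEnergyBound_ledgerB φ (v s) (rieszPressure (v s)) x₀ x| +
          2 * |∫ x in ball xs R, (φ x - 1) *
            hardyEnergyBound_ledgerFlux (v s) (rieszPressure (v s)) x₀ x| := by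
          refine (abs_sub _ _).trans (add_le_add (abs_add_le _ _) ?_)
          rw [abs_mul, abs_two]
      _ ≤ aA * (V + ∫ x, ‖v s x‖ ^ 3) + aB * (∫ x, ‖v s x‖ ^ 3) + 2 * (aD * ∫ x, ‖v s x‖ ^ 3) :=
          add_le_add (add_le_add h1 h2) (mul_le_mul_of_nonneg_left h3 zero_le_two)
      _ = α + β * ∫ x, ‖v s x‖ ^ 3 := by rw [hα, hβ]; ring
  -- (2) continuity in time on `K` of `Gf` and `F`
  have hGc : ContinuousOn Gf (Icc (T - R ^ 2) t) :=
    hardyEnergyBound_ledger_continuousOn_rhs hρ hx₀' hL₁0 hL₂0 hL₁x hL₂x hKc hKT hsm_v hsm_p ν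
  have hFc : ContinuousOn F (Icc (T - R ^ 2) t) := by
    have hcc : ContinuousOn c (Icc (T - R ^ 2) t) :=
      hardyEnergyBound_ledger_continuousOn_const hu hae hS'T hKS' hKc hsm_p hcK xs hR
    have h := (hardyEnergyBound_ledger_continuousOn_influx (x₀ := x₀) (xs := xs) (R := R) hKc hKT
      hsm_v hsm_p).sub (hcc.mul (hardyEnergyBound_ledger_continuousOn_moment (x₀ := x₀) (xs := xs)
        (R := R) hKc hKT hsm_v))
    refine h.congr fun s hs => ?_
    exact hardyEnergyBound_ledger_influx_eq (hvc s (hKT hs)) (hpc s (hKT hs)) (hcK s hs) x₀ xs R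
  have hGi : IntervalIntegrable Gf volume (T - R ^ 2) t := (hGc.mono hUI.subset).intervalIntegrable
  have hFi : IntervalIntegrable F volume (T - R ^ 2) t := (hFc.mono hUI.subset).intervalIntegrable
  -- (3) the identity between `T - R²` and `t`
  have hId : (∫ x, φ x * ‖v t x‖ ^ 2 / ‖x - x₀‖) - (∫ x, φ x * ‖v (T - R ^ 2) x‖ ^ 2 / ‖x - x₀‖) +
      2 * ν * (∫ s in (T - R ^ 2)..t, X s) + 4 * Real.pi * ν * φ x₀ * (∫ s in (T - R ^ 2)..t, Y s) =
      ∫ s in (T - R ^ 2)..t, Gf s :=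
    stub_localHardyIdentity (Ioo 0 T) ν v p hIoo hcl φ hφs hφc x₀ (T - R ^ 2) t ht1 hKT
  have hφ1 : φ x₀ = 1 := hardyEnergyBound_ledger_cutoff_sink x₀ hρ hx₀'
  rw [hφ1, mul_one] at hId
  have hIG : (∫ s in (T - R ^ 2)..t, Gf s) + 2 * (∫ s in (T - R ^ 2)..t, F s) =
      ∫ s in (T - R ^ 2)..t, Φ s := by
    rw [← intervalIntegral.integral_const_mul, ← intervalIntegral.integral_add hGi (hFi.const_mul 2)]
    refine intervalIntegral.integral_congr fun s hs => ?_
    rw [hUI] at hs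
    simp only [hGΦ s hs]
    ring
  -- (4) the bound `ofReal (−∫Φ) ≤ C₁`
  have hΦe : ∀ s ∈ Icc (T - R ^ 2) t, ‖Φ s‖ₑ ≤ ENNReal.ofReal α + ENNReal.ofReal β * ∫⁻ x, ‖v s x‖ₑ ^ 3 :=
    fun s hs => by
    have hN0 : 0 ≤ ∫ x, ‖v s x‖ ^ 3 := integral_nonneg fun x => by positivity
    rw [Real.enorm_eq_ofReal_abs, ← hardyEnergyBound_ledger_ofReal_integral_cube (hv3 s (hKT hs)),
      ← ENNReal.ofReal_mul hβ0, ← ENNReal.ofReal_add hα0 (mul_nonneg hβ0 hN0)]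
    exact ENNReal.ofReal_le_ofReal (hΦb s hs)
  have hIΦ : ENNReal.ofReal (-(∫ s in (T - R ^ 2)..t, Φ s)) ≤ C₁ := by
    rw [intervalIntegral.integral_of_le ht1]
    calc ENNReal.ofReal (-(∫ s in Ioc (T - R ^ 2) t, Φ s))
        ≤ ‖∫ s in Ioc (T - R ^ 2) t, Φ s‖ₑ := by
          rw [Real.enorm_eq_ofReal_abs]; exact ENNReal.ofReal_le_ofReal (neg_le_abs _)
      _ ≤ ∫⁻ s in Ioc (T - R ^ 2) t, ‖Φ s‖ₑ := enorm_integral_le_lintegral_enorm _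
      _ ≤ ∫⁻ s in Ioc (T - R ^ 2) t, (ENNReal.ofReal α + ENNReal.ofReal β * ∫⁻ x, ‖v s x‖ₑ ^ 3) :=
          setLIntegral_mono' measurableSet_Ioc fun s hs => hΦe s (Ioc_subset_Icc_self hs)
      _ ≤ ∫⁻ s in Ioo (T - R ^ 2) T, (ENNReal.ofReal α + ENNReal.ofReal β * ∫⁻ x, ‖v s x‖ₑ ^ 3) :=
          lintegral_mono_set (Ioc_subset_Ioo_right htT)
      _ = ENNReal.ofReal α * volume (Ioo (T - R ^ 2) T) + ENNReal.ofReal β * N := by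
          rw [lintegral_add_left' aemeasurable_const, lintegral_const_mul' _ _ ENNReal.ofReal_ne_top,
            setLIntegral_const]
      _ = C₁ := by
          rw [hC₁, Real.volume_Ioo]
          congr 2
          congr 1
          ring
  -- (5) the Hardy energy at time `t` from the pointwise bound `|v| ≤ A`
  have htI' : t ∈ Ioo (T - r ^ 2) T := hwin t ht1 htT
  have hH : ENNReal.ofReal (∫ x, φ x * ‖v t x‖ ^ 2 / ‖x - x₀‖) ≤ KH :=
    hardyEnergyBound_regular_ofReal_hardy_le hρ (fun x hx => (hAG t htI' x (hsubr hx)).1)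
  -- (6) the dissipation from the pointwise bounds `‖∇v‖ ≤ G`, `|v(x₀)| ≤ A`
  have hD : ENNReal.ofReal (2 * ν * (∫ s in (T - R ^ 2)..t, X s) +
      4 * Real.pi * ν * (∫ s in (T - R ^ 2)..t, Y s)) ≤ KD := by
    have hG' : ∀ s ∈ Ioo (T - R ^ 2) t, ∀ x ∈ ball x₀ (R / 4), ‖fderiv ℝ (v s) x‖ ≤ G :=
      fun s hs x hx => (hAG s (hwin s hs.1.le (hs.2.trans htT)) x (hsubr hx)).2
    have hA' : ∀ s ∈ Ioo (T - R ^ 2) t, ‖v s x₀‖ ≤ A :=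
      fun s hs => (hAG s (hwin s hs.1.le (hs.2.trans htT)) x₀ hx₀r).1
    have hvol : volume (Ioo (T - R ^ 2) t) ≤ volume (Ioo (T - R ^ 2) T) :=
      measure_mono (Ioo_subset_Ioo_right htT.le)
    calc ENNReal.ofReal (2 * ν * (∫ s in (T - R ^ 2)..t, X s) +
          4 * Real.pi * ν * (∫ s in (T - R ^ 2)..t, Y s))
        ≤ (ENNReal.ofReal (2 * ν) * (ENNReal.ofReal (3 * G ^ 2) *
              ENNReal.ofReal (5 / 2 * V₁ * (R / 4) ^ 2)) +
            ENNReal.ofReal (4 * Real.pi * ν) * ENNReal.ofReal (A ^ 2)) * volume (Ioo (T - R ^ 2) t) :=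
          hardyEnergyBound_regular_ofReal_dissipation_le hν.le hρ ht1 hG' hA'
      _ ≤ KD := by
          rw [hKD]
          exact mul_le_mul' le_rfl hvol
  -- (7) assembly in `ℝ`, then in `ℝ≥0∞`, then back in `ℝ`
  have hHt1 : 0 ≤ ∫ x, φ x * ‖v (T - R ^ 2) x‖ ^ 2 / ‖x - x₀‖ := integral_nonneg fun x =>
    div_nonneg (mul_nonneg (hardyEnergyBound_ledger_cutoff_nonneg x₀ hρ x) (by positivity)) (norm_nonneg _)
  change -2 * (∫ s in (T - R ^ 2)..t, F s) ≤ Mₑ.toReal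
  have hkey : -2 * (∫ s in (T - R ^ 2)..t, F s) ≤ (∫ x, φ x * ‖v t x‖ ^ 2 / ‖x - x₀‖) +
      (2 * ν * (∫ s in (T - R ^ 2)..t, X s) + 4 * Real.pi * ν * (∫ s in (T - R ^ 2)..t, Y s)) +
      (-(∫ s in (T - R ^ 2)..t, Φ s)) := by
    linarith [hId, hIG, hHt1]
  have hfinal : ENNReal.ofReal (-2 * ∫ s in (T - R ^ 2)..t, F s) ≤ Mₑ :=
    calc ENNReal.ofReal (-2 * ∫ s in (T - R ^ 2)..t, F s)
        ≤ ENNReal.ofReal ((∫ x, φ x * ‖v t x‖ ^ 2 / ‖x - x₀‖) +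
            (2 * ν * (∫ s in (T - R ^ 2)..t, X s) + 4 * Real.pi * ν * (∫ s in (T - R ^ 2)..t, Y s)) +
            (-(∫ s in (T - R ^ 2)..t, Φ s))) := ENNReal.ofReal_le_ofReal hkey
      _ ≤ ENNReal.ofReal ((∫ x, φ x * ‖v t x‖ ^ 2 / ‖x - x₀‖) +
            (2 * ν * (∫ s in (T - R ^ 2)..t, X s) + 4 * Real.pi * ν * (∫ s in (T - R ^ 2)..t, Y s))) +
          ENNReal.ofReal (-(∫ s in (T - R ^ 2)..t, Φ s)) := ENNReal.ofReal_add_le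
      _ ≤ ENNReal.ofReal (∫ x, φ x * ‖v t x‖ ^ 2 / ‖x - x₀‖) +
            ENNReal.ofReal (2 * ν * (∫ s in (T - R ^ 2)..t, X s) +
              4 * Real.pi * ν * (∫ s in (T - R ^ 2)..t, Y s)) +
          ENNReal.ofReal (-(∫ s in (T - R ^ 2)..t, Φ s)) := add_le_add ENNReal.ofReal_add_le le_rfl
      _ ≤ KH + KD + C₁ := add_le_add (add_le_add hH hD) hIΦ
      _ = Mₑ := rfl
  exact (ENNReal.ofReal_le_iff_le_toReal hMₑtop).1 hfinal

/-! ### The head influx classifies the backward singular points -/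

/-- **THE BACKWARD SINGULAR POINTS ARE EXACTLY THE POINTS THAT DRINK DIVERGENT HEAD.**  In the
frame of the crux `HardyEnergyBound` (`ν > 0`, Clay datum `u₀`, `T > 0`, Kato solution `u` on
`[0, T)` from `u₀`, classical representative `(v, p)` on `(0, T)`), for every `x_*`:
`(T, x_*)` is a backward singular point of `u` **iff** at EVERY scale `0 < R`, `R² < T` the
cumulative head influx toward `x_*`, `−2 I(x_*; T−R², t)`, exceeds every bound for all `t` close
to `T` (`→`: lead c6's `headInflux_unbounded_of_isBackwardSingularPoint`; `←`: at a regular point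
the influx is bounded above at some scale, `headInflux_le_of_not_isBackwardSingularPoint`).
[cite: CaffarelliKohnNirenberg1982, §2 and §8] -/
theorem isBackwardSingularPoint_iff_headInflux_unbounded {ν : ℝ} (hν : 0 < ν)
    {u₀ : EuclideanSpace ℝ (Fin 3) → EuclideanSpace ℝ (Fin 3)} (hsm₀ : ContDiff ℝ (⊤ : ℕ∞) u₀)
    (hdiv : NSWave0.IsDivFree u₀) (hdec : HasRapidSpatialDecay u₀) {T : ℝ} (hT : 0 < T)
    {u : ℝ → EuclideanSpace ℝ (Fin 3) → EuclideanSpace ℝ (Fin 3)} (hu : IsKatoSolutionOn T ν u₀ u)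
    {v : ℝ → EuclideanSpace ℝ (Fin 3) → EuclideanSpace ℝ (Fin 3)}
    {p : ℝ → EuclideanSpace ℝ (Fin 3) → ℝ} (hcl : IsClassicalNSSolutionOn (Ioo 0 T) ν 0 v p)
    (hae : ∀ t ∈ Ioo 0 T, v t =ᵐ[volume] u t) (xs : EuclideanSpace ℝ (Fin 3)) :
    IsBackwardSingularPoint u ((T, xs) : ℝ × EuclideanSpace ℝ (Fin 3)) ↔
      ∀ R : ℝ, 0 < R → R ^ 2 < T → ∀ M : ℝ, ∃ t₁ ∈ Ico (T - R ^ 2) T, ∀ t ∈ Ico t₁ T,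
        M ≤ -2 * ∫ s in (T - R ^ 2)..t, ∫ x in ball xs R,
          (‖v s x‖ ^ 2 / 2 + rieszPressure (v s) x) * inner ℝ (v s x) (x - xs) / ‖x - xs‖ ^ 3 := by
  constructor
  · intro hsing R hR hRT M
    exact headInflux_unbounded_of_isBackwardSingularPoint hν hsm₀ hdiv hdec hT hu hcl hae hsing hR hRT M
  · intro h
    by_contra hreg
    obtain ⟨R, hR, hRT, M, hM⟩ := headInflux_le_of_not_isBackwardSingularPoint hν hT hu hcl hae hreg
    have hxs : xs ∈ ball xs (R / 4) := mem_ball_self (by positivity)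
    obtain ⟨t₁, ht₁, hMt⟩ := h R hR hRT (M + 1)
    have h1 := hMt t₁ ⟨le_rfl, ht₁.2⟩
    have h2 := hM xs hxs t₁ ht₁
    linarith

/-! ### Registered anchor (pure `∀` form, fully qualified) -/

/-- **Anchor `hardyEnergyBound_isBackwardSingularPoint_iff_headInflux` (lead c7, `--supports
stmt-NavierStokesRegularity-7979`):** the pure `∀` form of
`isBackwardSingularPoint_iff_headInflux_unbounded`. [cite: CaffarelliKohnNirenberg1982, §2 and §8] -/
theorem hardyEnergyBound_isBackwardSingularPoint_iff_headInflux :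
    ∀ ν : ℝ, 0 < ν → ∀ u₀ : EuclideanSpace ℝ (Fin 3) → EuclideanSpace ℝ (Fin 3),
      ContDiff ℝ (⊤ : ℕ∞) u₀ → Literature.Analysis.FluidPDE.NSWave0.IsDivFree u₀ →
      Literature.Analysis.FluidPDE.HasRapidSpatialDecay u₀ →
      ∀ (T : ℝ) (u : ℝ → EuclideanSpace ℝ (Fin 3) → EuclideanSpace ℝ (Fin 3)), 0 < T →
      Literature.Analysis.FluidPDE.IsKatoSolutionOn T ν u₀ u →
      ∀ (v : ℝ → EuclideanSpace ℝ (Fin 3) → EuclideanSpace ℝ (Fin 3))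
        (p : ℝ → EuclideanSpace ℝ (Fin 3) → ℝ),
      Literature.Analysis.FluidPDE.IsClassicalNSSolutionOn (Set.Ioo 0 T) ν 0 v p →
      (∀ t ∈ Set.Ioo 0 T, v t =ᵐ[MeasureTheory.volume] u t) →
      ∀ xs : EuclideanSpace ℝ (Fin 3),
        (Literature.Analysis.FluidPDE.IsBackwardSingularPoint u
            ((T, xs) : ℝ × EuclideanSpace ℝ (Fin 3)) ↔
          ∀ R : ℝ, 0 < R → R ^ 2 < T → ∀ M : ℝ,
            ∃ t₁ ∈ Set.Ico (T - R ^ 2) T, ∀ t ∈ Set.Ico t₁ T,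
              M ≤ -2 * ∫ s in (T - R ^ 2)..t, ∫ x in Metric.ball xs R,
                (‖v s x‖ ^ 2 / 2 + Literature.Analysis.FluidPDE.rieszPressure (v s) x)
                  * inner ℝ (v s x) (x - xs) / ‖x - xs‖ ^ 3) :=
  fun _ν hν _u₀ hsm₀ hdiv hdec _T _u hT hu _v _p hcl hae xs =>
    isBackwardSingularPoint_iff_headInflux_unbounded hν hsm₀ hdiv hdec hT hu hcl hae xs

end Summit.NavierStokesRegularity.NavierStokesRegularity.Theorems

end
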